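import Summits.BirchSwinnertonDyer.BirchSwinnertonDyer.Theorems.MordellShaFreeCutLocNonDegeneracy
import Summits.BirchSwinnertonDyer.BirchSwinnertonDyer.Theorems.CongruentShaFreeCutSelmerFiniteOfRes
import Summits.BirchSwinnertonDyer.BirchSwinnertonDyer.Theorems.CongruentShaFreeCutTwoAdicControlOfSelmerFinite
import Summits.BirchSwinnertonDyer.Rank1Residual.GaloisImage.PropagatedConditionCardEP

set_option autoImplicit false

/-! # Route `MordellShaFreeCut` (rung S2b) — KERNEL CENSUS of the residual crux A
`RankPosOfThreeSelmerCorankOne` (stmt-BirchSwinnertonDyer-19159) after the v5 cut: modulo Link B,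
Poitou–Tate and the refereed facts, crux A ⟺ Skinner's (res) at `3`; the whole rung-S2b leaf
⟸ {(res) at `3`, Link B} + Poitou–Tate + refereed facts

Cell `bsd-cn100`, prover seat `bsd-cn100-s2b-c3` g3. Supports, does not close,
stmt-BirchSwinnertonDyer-19159 (`--supports … --as helper`). HONEST FRAMING: CONDITIONAL reductions;
nothing here proves crux A, crux B, the leaf `rankOne_threeConverse_mordellCurve`, Sylvester's conjecture
or any case of BSD. No research statement is restated as a definition: (res) at `3` enters as the
hypothesis `hres`, spelled EXACTLY as the registered stub `stub_threeLocNonDegeneracy` of line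
`heegner-field-links` v5 (skeleton 78cca4aa); the W,p-general algebra statement enters as the hypothesis
`halg`, spelled EXACTLY as the registered stub `stub_selmerAcBaseFinite_of_resCorankOne` (token-identical on
stmt-19079/19159; CLAIMED by transfer-2 g3 2026-08-26T09:24Z — ~90 % landed as p433381/p433383/p433655 in
level currency, the (res)-to-level bridge in filing; once it lands, `halg` is discharged by name in an
APPEND to this file); Link B by its landed name `MordellShaFreeCutThreeAdicLinks.ThreeAdicCharValueEqHeegnerLogSq`
(p424081). The tower control is the landed `hasCharValuationAt_of_finite_selmerAcBase` (s2-c3 g3, p429171);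
the local Euler characteristic is the tree theorem `GaloisImage.EP.forall_localEulerPoincareCharacteristic_adicCompletion`.

* `threeAdicControlOfCorankOne_of_res_of_poitouTate` — Link A in CORANK currency
  (`MordellShaFreeCutThreeAdicLinksCorank.ThreeAdicControlOfCorankOne`, p425339) ⟸ (res) at `3` +
  Poitou–Tate;
* `cruxA_of_res_of_linkB_of_poitouTate`, **`cruxA_iff_res_of_linkB_of_poitouTate`** — with
  `MordellShaFreeCutLocNonDegeneracy.threeLocNonDegeneracy_of_cruxA` (p435058): modulo Link B +
  Poitou–Tate + the algebra statement + {`3`-parity, modularity, Hoffstein–Luo, Kato, Gross 1984}, crux A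
  is EQUIVALENT to (res) at `3` — the residual's research content is located at ONE Selmer-only statement;
* `leaf_of_res_of_linkB_of_poitouTate` — the rung-S2b leaf `rankOne_threeConverse_mordellCurve` from
  {(res) at `3`, Link B} + Poitou–Tate + the algebra statement + the six refereed facts
  (`leaf_of_threeAdicLinks`, p425339).

[cite: Skinner2020, Thm. B and §2.2–2.3 (shape of (res); Lemma 2.3.2)] [cite: CastellaGrossiLeeSkinner2022, §5.2 (proof of Thm. 5.2.1)]
[cite: MilneADT2006, Ch. I, Thm. 4.10(b) and Thm. 2.8] [cite: GrossZagier1986, Thm. I.6.3 with V.§2] -/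

noncomputable section

open scoped Classical

namespace Summit.BirchSwinnertonDyer.BirchSwinnertonDyer.Theorems.MordellShaFreeCutResidualCensus

open WeierstrassCurve NumberField IsDedekindDomain Field
open Literature.NumberTheory.EllipticCurves Literature.NumberTheory.EllipticCurves.Castella2018
open Literature.NumberTheory.GaloisRepresentations Literature.NumberTheory.GaloisCohomology
open Summit.BirchSwinnertonDyer.Rank1Residual.X11b
open Summit.BirchSwinnertonDyer.Rank1Residual.X11b.AcSelmer
open Summit.BirchSwinnertonDyer.Rank1Residual.GaloisImage.EP (forall_localEulerPoincareCharacteristic_adicCompletion)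
open Summit.BirchSwinnertonDyer.BirchSwinnertonDyer.Theses.MordellShaFreeCut
open Summit.BirchSwinnertonDyer.BirchSwinnertonDyer.Theorems.MordellShaFreeCutThreeAdicLinks
  (ThreeAdicCharValueEqHeegnerLogSq)
open Summit.BirchSwinnertonDyer.BirchSwinnertonDyer.Theorems.MordellShaFreeCutThreeAdicLinksCorank
  (ThreeAdicControlOfCorankOne cruxA_of_threeAdicLinks leaf_of_threeAdicLinks)
open Summit.BirchSwinnertonDyer.BirchSwinnertonDyer.Theorems.CongruentShaFreeCutTwoAdicControlOfSelmerFinite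
  (hasCharValuationAt_of_finite_selmerAcBase)
open Summit.BirchSwinnertonDyer.BirchSwinnertonDyer.Theorems.MordellShaFreeCutLocNonDegeneracy
  (threeLocNonDegeneracy_of_cruxA)

/-! ## 1. Link A in corank currency from (res) at `3` and Poitou–Tate -/

/-- **Link A in CORANK currency `ThreeAdicControlOfCorankOne` ⟸ (res) at `3` + Poitou–Tate.** At a
datum (`W/ℚ` globally minimal elliptic with `j = 0`; `K` imaginary quadratic with the Heegner hypothesis
for `3`, so `3` splits; `v̄ ∋ 3`; `κ`, `γ`; `corank_{ℤ₃} Sel_{3^∞}(W/K) = 1`): (res) at the primes above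
`3` (`hres`, the registered `stub_threeLocNonDegeneracy` statement) and the W,p-general algebra theorem
`stub_selmerAcBaseFinite_of_resCorankOne` (`halg`; Poitou–Tate `hPT`, local Euler characteristic from the
tree) make Castella's `Sel_{v̄}(K, W[3^∞])` finite, and the tower control
`hasCharValuationAt_of_finite_selmerAcBase W 3` (p429171) gives `∃ m, HasCharValuationAt … m`.
CONDITIONAL; credits nothing. [cite: Skinner2020, §2.3 Lemma 2.3.2 (shape)]
[cite: MilneADT2006, Ch. I, Thm. 4.10(b) and Thm. 2.8] -/
theorem threeAdicControlOfCorankOne_of_res_of_poitouTate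
    (hPT : ∀ (K : Type) [Field K] [NumberField K], poitouTate_sum_localTatePairing_eq_zero K)
    (halg : ∀ (W : WeierstrassCurve ℚ) [W.IsElliptic] [W.IsGloballyMinimal] (p : ℕ) [Fact p.Prime]
      (K : Type) [Field K] [NumberField K],
      poitouTate_sum_localTatePairing_eq_zero K →
      (∀ v : HeightOneSpectrum (𝓞 K), localEulerPoincareCharacteristic (v.adicCompletion K)) →
      IsImaginaryQuadratic K → Summit.BirchSwinnertonDyer.Rank1Residual.X11b.SplitsIn K p →
      (W.baseChange K).selmerCorank p = 1 →
      (∀ (w : HeightOneSpectrum (𝓞 K)), ((p : ℕ) : 𝓞 K) ∈ w.asIdeal →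
        Finite ↥((W.baseChange K).selmerGroupPInfty p ⊓
          selmerLocalKerPrimaryTorsion (W.baseChange K) (w.adicCompletion K) p)) →
      ∀ (𝔭 : HeightOneSpectrum (𝓞 K)), ((p : ℕ) : 𝓞 K) ∈ 𝔭.asIdeal →
        Finite (Summit.BirchSwinnertonDyer.Rank1Residual.X11b.AcSelmer.selmerAcBase (W.baseChange K) p 𝔭 ∅))
    (hres : ∀ (W : WeierstrassCurve ℚ) [W.IsElliptic] [W.IsGloballyMinimal], W.j = 0 →
      ∀ (K : Type) [Field K] [NumberField K],
      IsImaginaryQuadratic K → SatisfiesHeegnerHypothesis 3 K →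
        (W.baseChange K).selmerCorank 3 = 1 →
      ∀ (w : HeightOneSpectrum (𝓞 K)), ((3 : ℕ) : 𝓞 K) ∈ w.asIdeal →
        Finite ↥((W.baseChange K).selmerGroupPInfty 3 ⊓
          selmerLocalKerPrimaryTorsion (W.baseChange K) (w.adicCompletion K) 3)) :
    ThreeAdicControlOfCorankOne := by
  intro W _ _ hj K _ _ N _ _hN hK _hHN hH3 ι v vbar _hv hvbar _hne κ hκ γ _ hcK
  have hsplit : SplitsIn K 3 := hH3 3 Fact.out (dvd_refl 3)
  haveI : Finite (selmerAcBase (W.baseChange K) 3 vbar ∅) :=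
    halg W 3 K (hPT K) (forall_localEulerPoincareCharacteristic_adicCompletion K) hK hsplit hcK
      (hres W hj K hK hH3 hcK) vbar hvbar
  exact hasCharValuationAt_of_finite_selmerAcBase W 3 hK hsplit κ hκ γ vbar hvbar

/-! ## 2. Crux A ⟺ (res) at `3`, modulo Link B, Poitou–Tate and the refereed facts -/

/-- **Crux A `RankPosOfThreeSelmerCorankOne` from (res) at `3`, Link B, Poitou–Tate and five refereed
facts** (`3`-parity, modularity, Hoffstein–Luo, Kato, Gross 1984): `cruxA_of_threeAdicLinks` (p425339)
fed with `threeAdicControlOfCorankOne_of_res_of_poitouTate`. CONDITIONAL; credits nothing.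
[cite: CastellaGrossiLeeSkinner2022, §5.2 (proof of Thm. 5.2.1)] [cite: Skinner2020, Thm. B (shape)] -/
theorem cruxA_of_res_of_linkB_of_poitouTate
    (hpar : ∀ (W : WeierstrassCurve ℚ) [W.IsElliptic] (p : ℕ) [Fact p.Prime], p_parity W p)
    (hmod : ModularForms.exists_isNewformOf) (hHL : HoffsteinLuo1997_exists_twist_L_one_ne_zero)
    (hKato : ∀ (W : WeierstrassCurve ℚ) [W.IsElliptic] (p : ℕ) [Fact p.Prime],
      kato_finite_of_L_one_ne_zero W p)
    (hHP : ∀ (W : WeierstrassCurve ℚ) (K : Type) [Field K] [NumberField K],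
      exists_isHeegnerPoint W K)
    (hPT : ∀ (K : Type) [Field K] [NumberField K], poitouTate_sum_localTatePairing_eq_zero K)
    (halg : ∀ (W : WeierstrassCurve ℚ) [W.IsElliptic] [W.IsGloballyMinimal] (p : ℕ) [Fact p.Prime]
      (K : Type) [Field K] [NumberField K],
      poitouTate_sum_localTatePairing_eq_zero K →
      (∀ v : HeightOneSpectrum (𝓞 K), localEulerPoincareCharacteristic (v.adicCompletion K)) →
      IsImaginaryQuadratic K → Summit.BirchSwinnertonDyer.Rank1Residual.X11b.SplitsIn K p →
      (W.baseChange K).selmerCorank p = 1 →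
      (∀ (w : HeightOneSpectrum (𝓞 K)), ((p : ℕ) : 𝓞 K) ∈ w.asIdeal →
        Finite ↥((W.baseChange K).selmerGroupPInfty p ⊓
          selmerLocalKerPrimaryTorsion (W.baseChange K) (w.adicCompletion K) p)) →
      ∀ (𝔭 : HeightOneSpectrum (𝓞 K)), ((p : ℕ) : 𝓞 K) ∈ 𝔭.asIdeal →
        Finite (Summit.BirchSwinnertonDyer.Rank1Residual.X11b.AcSelmer.selmerAcBase (W.baseChange K) p 𝔭 ∅))
    (hres : ∀ (W : WeierstrassCurve ℚ) [W.IsElliptic] [W.IsGloballyMinimal], W.j = 0 →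
      ∀ (K : Type) [Field K] [NumberField K],
      IsImaginaryQuadratic K → SatisfiesHeegnerHypothesis 3 K →
        (W.baseChange K).selmerCorank 3 = 1 →
      ∀ (w : HeightOneSpectrum (𝓞 K)), ((3 : ℕ) : 𝓞 K) ∈ w.asIdeal →
        Finite ↥((W.baseChange K).selmerGroupPInfty 3 ⊓
          selmerLocalKerPrimaryTorsion (W.baseChange K) (w.adicCompletion K) 3))
    (hB : ThreeAdicCharValueEqHeegnerLogSq) :
    RankPosOfThreeSelmerCorankOne :=
  cruxA_of_threeAdicLinks hpar hmod hHL hKato hHP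
    (threeAdicControlOfCorankOne_of_res_of_poitouTate hPT halg hres) hB

/-- **KERNEL CENSUS of the residual: modulo Link B, Poitou–Tate, the W,p-general algebra theorem and the
five refereed facts, crux A `RankPosOfThreeSelmerCorankOne` is EQUIVALENT to (res) at `3`** (the
registered `stub_threeLocNonDegeneracy` statement): `⟸` is `cruxA_of_res_of_linkB_of_poitouTate`, `⟹` is
the fact-free `MordellShaFreeCutLocNonDegeneracy.threeLocNonDegeneracy_of_cruxA` (p435058). So the v5 cut
locates the residual's research content at ONE Selmer-only statement (no `L`-function, no tower, no Heegner
point) plus Link B. CONDITIONAL; credits nothing. [cite: Skinner2020, Thm. B and §2.2 (shape of (res))]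
[cite: WZhang2014, Thm. 1.3 and Remark 2 (p. 198) ((res) removed at good ordinary p ≥ 5)] -/
theorem cruxA_iff_res_of_linkB_of_poitouTate
    (hpar : ∀ (W : WeierstrassCurve ℚ) [W.IsElliptic] (p : ℕ) [Fact p.Prime], p_parity W p)
    (hmod : ModularForms.exists_isNewformOf) (hHL : HoffsteinLuo1997_exists_twist_L_one_ne_zero)
    (hKato : ∀ (W : WeierstrassCurve ℚ) [W.IsElliptic] (p : ℕ) [Fact p.Prime],
      kato_finite_of_L_one_ne_zero W p)
    (hHP : ∀ (W : WeierstrassCurve ℚ) (K : Type) [Field K] [NumberField K],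
      exists_isHeegnerPoint W K)
    (hPT : ∀ (K : Type) [Field K] [NumberField K], poitouTate_sum_localTatePairing_eq_zero K)
    (halg : ∀ (W : WeierstrassCurve ℚ) [W.IsElliptic] [W.IsGloballyMinimal] (p : ℕ) [Fact p.Prime]
      (K : Type) [Field K] [NumberField K],
      poitouTate_sum_localTatePairing_eq_zero K →
      (∀ v : HeightOneSpectrum (𝓞 K), localEulerPoincareCharacteristic (v.adicCompletion K)) →
      IsImaginaryQuadratic K → Summit.BirchSwinnertonDyer.Rank1Residual.X11b.SplitsIn K p →
      (W.baseChange K).selmerCorank p = 1 →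
      (∀ (w : HeightOneSpectrum (𝓞 K)), ((p : ℕ) : 𝓞 K) ∈ w.asIdeal →
        Finite ↥((W.baseChange K).selmerGroupPInfty p ⊓
          selmerLocalKerPrimaryTorsion (W.baseChange K) (w.adicCompletion K) p)) →
      ∀ (𝔭 : HeightOneSpectrum (𝓞 K)), ((p : ℕ) : 𝓞 K) ∈ 𝔭.asIdeal →
        Finite (Summit.BirchSwinnertonDyer.Rank1Residual.X11b.AcSelmer.selmerAcBase (W.baseChange K) p 𝔭 ∅))
    (hB : ThreeAdicCharValueEqHeegnerLogSq) :
    RankPosOfThreeSelmerCorankOne ↔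
      ∀ (W : WeierstrassCurve ℚ) [W.IsElliptic] [W.IsGloballyMinimal], W.j = 0 →
        ∀ (K : Type) [Field K] [NumberField K],
        IsImaginaryQuadratic K → SatisfiesHeegnerHypothesis 3 K →
          (W.baseChange K).selmerCorank 3 = 1 →
        ∀ (w : HeightOneSpectrum (𝓞 K)), ((3 : ℕ) : 𝓞 K) ∈ w.asIdeal →
          Finite ↥((W.baseChange K).selmerGroupPInfty 3 ⊓
            selmerLocalKerPrimaryTorsion (W.baseChange K) (w.adicCompletion K) 3) :=
  ⟨fun hA W _ _ hj K _ _ hK hH3 hcK w hw ↦ threeLocNonDegeneracy_of_cruxA hA W hj K hK hH3 hcK w hw,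
    fun hres ↦ cruxA_of_res_of_linkB_of_poitouTate hpar hmod hHL hKato hHP hPT halg hres hB⟩

/-! ## 3. The whole rung-S2b leaf from {(res) at `3`, Link B} -/

/-- **The rung-S2b leaf `rankOne_threeConverse_mordellCurve` from (res) at `3`, Link B, Poitou–Tate and
the six refereed facts** (`3`-parity, modularity, Hoffstein–Luo, Kato, Gross 1984, Gross–Zagier +
Kolyvagin): `leaf_of_threeAdicLinks` (p425339: crux A from the corank link, crux B from the rank link it
implies, the route's Assembly) fed with `threeAdicControlOfCorankOne_of_res_of_poitouTate`. KERNEL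
CENSUS of route S2b after v5: leaf ⟸ {(res) at `3` [XL, Selmer currency], Link B
`ThreeAdicCharValueEqHeegnerLogSq` [XL]} + Poitou–Tate [textbook] + six refereed facts. CONDITIONAL;
neither BSD nor Sylvester's conjecture is touched. [cite: GrossZagier1986, Thm. I.6.3 with V.§2]
[cite: CastellaGrossiLeeSkinner2022, §5.2 (proof of Thm. 5.2.1)] [cite: MilneADT2006, Ch. I, Thm. 4.10(b)] -/
theorem leaf_of_res_of_linkB_of_poitouTate
    (hpar : ∀ (W : WeierstrassCurve ℚ) [W.IsElliptic] (p : ℕ) [Fact p.Prime], p_parity W p)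
    (hmod : ModularForms.exists_isNewformOf) (hHL : HoffsteinLuo1997_exists_twist_L_one_ne_zero)
    (hKato : ∀ (W : WeierstrassCurve ℚ) [W.IsElliptic] (p : ℕ) [Fact p.Prime],
      kato_finite_of_L_one_ne_zero W p)
    (hHP : ∀ (W : WeierstrassCurve ℚ) (K : Type) [Field K] [NumberField K],
      exists_isHeegnerPoint W K)
    (hGZ : ∀ (W : WeierstrassCurve ℚ) (N : ℕ) [NeZero N] (K : Type) [Field K] [NumberField K],
      analyticRankEK_eq_one_iff_heegner_nonTorsion W N K)
    (hPT : ∀ (K : Type) [Field K] [NumberField K], poitouTate_sum_localTatePairing_eq_zero K)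
    (halg : ∀ (W : WeierstrassCurve ℚ) [W.IsElliptic] [W.IsGloballyMinimal] (p : ℕ) [Fact p.Prime]
      (K : Type) [Field K] [NumberField K],
      poitouTate_sum_localTatePairing_eq_zero K →
      (∀ v : HeightOneSpectrum (𝓞 K), localEulerPoincareCharacteristic (v.adicCompletion K)) →
      IsImaginaryQuadratic K → Summit.BirchSwinnertonDyer.Rank1Residual.X11b.SplitsIn K p →
      (W.baseChange K).selmerCorank p = 1 →
      (∀ (w : HeightOneSpectrum (𝓞 K)), ((p : ℕ) : 𝓞 K) ∈ w.asIdeal →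
        Finite ↥((W.baseChange K).selmerGroupPInfty p ⊓
          selmerLocalKerPrimaryTorsion (W.baseChange K) (w.adicCompletion K) p)) →
      ∀ (𝔭 : HeightOneSpectrum (𝓞 K)), ((p : ℕ) : 𝓞 K) ∈ 𝔭.asIdeal →
        Finite (Summit.BirchSwinnertonDyer.Rank1Residual.X11b.AcSelmer.selmerAcBase (W.baseChange K) p 𝔭 ∅))
    (hres : ∀ (W : WeierstrassCurve ℚ) [W.IsElliptic] [W.IsGloballyMinimal], W.j = 0 →
      ∀ (K : Type) [Field K] [NumberField K],
      IsImaginaryQuadratic K → SatisfiesHeegnerHypothesis 3 K →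
        (W.baseChange K).selmerCorank 3 = 1 →
      ∀ (w : HeightOneSpectrum (𝓞 K)), ((3 : ℕ) : 𝓞 K) ∈ w.asIdeal →
        Finite ↥((W.baseChange K).selmerGroupPInfty 3 ⊓
          selmerLocalKerPrimaryTorsion (W.baseChange K) (w.adicCompletion K) 3))
    (hB : ThreeAdicCharValueEqHeegnerLogSq) :
    rankOne_threeConverse_mordellCurve :=
  leaf_of_threeAdicLinks hpar hmod hHL hKato hHP hGZ
    (threeAdicControlOfCorankOne_of_res_of_poitouTate hPT halg hres) hB

/-! ## 4. APPEND (2026-08-26, same seat): the algebra statement DISCHARGED — transfer-2 g3 landed the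
registered stub as `CongruentShaFreeCutSelmerFiniteOfRes.stub_selmerAcBaseFinite_of_resCorankOne`
(W,p-general; rank dichotomy: Part A outright in rank one, the `p^k ↦ p^∞` bridge in rank zero), so `halg`
is now a tree theorem and every statement of §§1–3 holds WITHOUT it. -/

/-- **Link A in CORANK currency `ThreeAdicControlOfCorankOne` ⟸ (res) at `3` + Poitou–Tate** — §1 with
`halg` := the landed `stub_selmerAcBaseFinite_of_resCorankOne`. CONDITIONAL on (res) and PT; credits
nothing. [cite: Skinner2020, §2.3 Lemma 2.3.2 (shape)] [cite: MilneADT2006, Ch. I, Thm. 4.10(b)] -/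
theorem threeAdicControlOfCorankOne_of_res
    (hPT : ∀ (K : Type) [Field K] [NumberField K], poitouTate_sum_localTatePairing_eq_zero K)
    (hres : ∀ (W : WeierstrassCurve ℚ) [W.IsElliptic] [W.IsGloballyMinimal], W.j = 0 →
      ∀ (K : Type) [Field K] [NumberField K],
      IsImaginaryQuadratic K → SatisfiesHeegnerHypothesis 3 K →
        (W.baseChange K).selmerCorank 3 = 1 →
      ∀ (w : HeightOneSpectrum (𝓞 K)), ((3 : ℕ) : 𝓞 K) ∈ w.asIdeal →
        Finite ↥((W.baseChange K).selmerGroupPInfty 3 ⊓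
          selmerLocalKerPrimaryTorsion (W.baseChange K) (w.adicCompletion K) 3)) :
    ThreeAdicControlOfCorankOne :=
  threeAdicControlOfCorankOne_of_res_of_poitouTate hPT
    Summit.BirchSwinnertonDyer.BirchSwinnertonDyer.Theorems.CongruentShaFreeCutSelmerFiniteOfRes.stub_selmerAcBaseFinite_of_resCorankOne
    hres

/-- **Crux A ⟸ (res) + Link B + Poitou–Tate + five refereed facts** — §2 with `halg` discharged.
CONDITIONAL; credits nothing. [cite: CastellaGrossiLeeSkinner2022, §5.2 (proof of Thm. 5.2.1)] -/
theorem cruxA_of_res_of_linkB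
    (hpar : ∀ (W : WeierstrassCurve ℚ) [W.IsElliptic] (p : ℕ) [Fact p.Prime], p_parity W p)
    (hmod : ModularForms.exists_isNewformOf) (hHL : HoffsteinLuo1997_exists_twist_L_one_ne_zero)
    (hKato : ∀ (W : WeierstrassCurve ℚ) [W.IsElliptic] (p : ℕ) [Fact p.Prime],
      kato_finite_of_L_one_ne_zero W p)
    (hHP : ∀ (W : WeierstrassCurve ℚ) (K : Type) [Field K] [NumberField K],
      exists_isHeegnerPoint W K)
    (hPT : ∀ (K : Type) [Field K] [NumberField K], poitouTate_sum_localTatePairing_eq_zero K)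
    (hres : ∀ (W : WeierstrassCurve ℚ) [W.IsElliptic] [W.IsGloballyMinimal], W.j = 0 →
      ∀ (K : Type) [Field K] [NumberField K],
      IsImaginaryQuadratic K → SatisfiesHeegnerHypothesis 3 K →
        (W.baseChange K).selmerCorank 3 = 1 →
      ∀ (w : HeightOneSpectrum (𝓞 K)), ((3 : ℕ) : 𝓞 K) ∈ w.asIdeal →
        Finite ↥((W.baseChange K).selmerGroupPInfty 3 ⊓
          selmerLocalKerPrimaryTorsion (W.baseChange K) (w.adicCompletion K) 3))
    (hB : ThreeAdicCharValueEqHeegnerLogSq) :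
    RankPosOfThreeSelmerCorankOne :=
  cruxA_of_res_of_linkB_of_poitouTate hpar hmod hHL hKato hHP hPT
    Summit.BirchSwinnertonDyer.BirchSwinnertonDyer.Theorems.CongruentShaFreeCutSelmerFiniteOfRes.stub_selmerAcBaseFinite_of_resCorankOne
    hres hB

/-- **KERNEL CENSUS, final form: modulo Link B, Poitou–Tate and the five refereed facts, crux A
⟺ (res) at `3`** (the registered `stub_threeLocNonDegeneracy` statement) — §2 with `halg` discharged by the
landed algebra theorem. The residual's research content is ONE Selmer-only statement + Link B.
CONDITIONAL; credits nothing. [cite: Skinner2020, Thm. B and §2.2 (shape of (res))]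
[cite: WZhang2014, Thm. 1.3 and Remark 2 (p. 198)] -/
theorem cruxA_iff_res_of_linkB
    (hpar : ∀ (W : WeierstrassCurve ℚ) [W.IsElliptic] (p : ℕ) [Fact p.Prime], p_parity W p)
    (hmod : ModularForms.exists_isNewformOf) (hHL : HoffsteinLuo1997_exists_twist_L_one_ne_zero)
    (hKato : ∀ (W : WeierstrassCurve ℚ) [W.IsElliptic] (p : ℕ) [Fact p.Prime],
      kato_finite_of_L_one_ne_zero W p)
    (hHP : ∀ (W : WeierstrassCurve ℚ) (K : Type) [Field K] [NumberField K],
      exists_isHeegnerPoint W K)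
    (hPT : ∀ (K : Type) [Field K] [NumberField K], poitouTate_sum_localTatePairing_eq_zero K)
    (hB : ThreeAdicCharValueEqHeegnerLogSq) :
    RankPosOfThreeSelmerCorankOne ↔
      ∀ (W : WeierstrassCurve ℚ) [W.IsElliptic] [W.IsGloballyMinimal], W.j = 0 →
      ∀ (K : Type) [Field K] [NumberField K],
      IsImaginaryQuadratic K → SatisfiesHeegnerHypothesis 3 K →
        (W.baseChange K).selmerCorank 3 = 1 →
      ∀ (w : HeightOneSpectrum (𝓞 K)), ((3 : ℕ) : 𝓞 K) ∈ w.asIdeal →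
        Finite ↥((W.baseChange K).selmerGroupPInfty 3 ⊓
          selmerLocalKerPrimaryTorsion (W.baseChange K) (w.adicCompletion K) 3) :=
  cruxA_iff_res_of_linkB_of_poitouTate hpar hmod hHL hKato hHP hPT
    Summit.BirchSwinnertonDyer.BirchSwinnertonDyer.Theorems.CongruentShaFreeCutSelmerFiniteOfRes.stub_selmerAcBaseFinite_of_resCorankOne
    hB

/-- **The leaf ⟸ {(res) at `3`, Link B} + Poitou–Tate + the six refereed facts** — §3 with `halg`
discharged. KERNEL CENSUS of the route after v5 + the algebra landing: research = (res) [XL, Selmer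
currency] + Link B [XL]; textbook = Poitou–Tate; refereed = six named facts. CONDITIONAL; BSD untouched.
[cite: GrossZagier1986, Thm. I.6.3 with V.§2] [cite: CastellaGrossiLeeSkinner2022, §5.2 (proof of Thm. 5.2.1)] -/
theorem leaf_of_res_of_linkB
    (hpar : ∀ (W : WeierstrassCurve ℚ) [W.IsElliptic] (p : ℕ) [Fact p.Prime], p_parity W p)
    (hmod : ModularForms.exists_isNewformOf) (hHL : HoffsteinLuo1997_exists_twist_L_one_ne_zero)
    (hKato : ∀ (W : WeierstrassCurve ℚ) [W.IsElliptic] (p : ℕ) [Fact p.Prime],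
      kato_finite_of_L_one_ne_zero W p)
    (hHP : ∀ (W : WeierstrassCurve ℚ) (K : Type) [Field K] [NumberField K],
      exists_isHeegnerPoint W K)
    (hGZ : ∀ (W : WeierstrassCurve ℚ) (N : ℕ) [NeZero N] (K : Type) [Field K] [NumberField K],
      analyticRankEK_eq_one_iff_heegner_nonTorsion W N K)
    (hPT : ∀ (K : Type) [Field K] [NumberField K], poitouTate_sum_localTatePairing_eq_zero K)
    (hres : ∀ (W : WeierstrassCurve ℚ) [W.IsElliptic] [W.IsGloballyMinimal], W.j = 0 →
      ∀ (K : Type) [Field K] [NumberField K],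
      IsImaginaryQuadratic K → SatisfiesHeegnerHypothesis 3 K →
        (W.baseChange K).selmerCorank 3 = 1 →
      ∀ (w : HeightOneSpectrum (𝓞 K)), ((3 : ℕ) : 𝓞 K) ∈ w.asIdeal →
        Finite ↥((W.baseChange K).selmerGroupPInfty 3 ⊓
          selmerLocalKerPrimaryTorsion (W.baseChange K) (w.adicCompletion K) 3))
    (hB : ThreeAdicCharValueEqHeegnerLogSq) :
    rankOne_threeConverse_mordellCurve :=
  leaf_of_res_of_linkB_of_poitouTate hpar hmod hHL hKato hHP hGZ hPT
    Summit.BirchSwinnertonDyer.BirchSwinnertonDyer.Theorems.CongruentShaFreeCutSelmerFiniteOfRes.stub_selmerAcBaseFinite_of_resCorankOne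
    hres hB

end Summit.BirchSwinnertonDyer.BirchSwinnertonDyer.Theorems.MordellShaFreeCutResidualCensus

end
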